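import Literature.AlgebraicGeometry.HodgeTheory.DworkSexticFlatEigenclassesHodgeType
import Literature.AlgebraicGeometry.HodgeTheory.FermatEigenspaceVanishing
import HarnessLib

/-!
# Rank one of the singleton eigenspaces of the Dwork sextic from an equivariant transport to the
# Fermat point (Katz 2009, Lemma 3.1(1), the type `(1,2,3,3,4,5)`)

Family `hodge`, layer `Literature/AlgebraicGeometry/HodgeTheory`; companion of
`DworkSexticSingletonPurity` (purity `(2,2)` of the singleton flat eigenlines of
`X_ψ : Σ xᵢ⁶ − 6ψ ∏ xᵢ = 0` from symmetry AND the rank bound `dim V_e(ψ) ≤ 1`). Written for crux K2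
`FlatClassesSpannedByReflectionInvariants` (stmt-HodgeConjecture-20241) of route
`HodgeConjecture/DworkReflectionQuotients`.

N. M. Katz, *Another look at the Dwork family*, Progr. Math. 270 (2009), **Lemma 3.1(1)**: the
eigensheaf `Prim⁴(V mod W)` of the character `V = e mod 6` of `Γ_W/Δ` on the family `X_ψ`, `ψ⁶ ≠ 1`,
has rank `#{r ∈ ℤ/6 : e + r·𝟙 totally nonzero}`; for the singleton type `e = (1,2,3,3,4,5) ∘ σ` this is
`1`. Katz's proof: the eigensheaves are local systems on `{ψ⁶ ≠ 1}` (`Γ_W` acts on the whole family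
over the base, and `R⁴π_*ℂ` is a local system — Ehresmann, Voisin I §9.2.1 / Voisin II §3.1.2), so
the rank is the dimension at the Fermat point `ψ = 0`, where `H⁴(X⁴₆)` decomposes under the full
torus `μ₆⁶ ⊇ Γ_W` into the lines `V(α)`, `α` totally nonzero (Shioda 1979 §1, Ran 1980 Prop. 1.7 (i)),
and the `Γ_W`-eigenspace of `χ_e` collects the `V(e + r·𝟙)`.

THIS FILE proves the part of this argument that the tree can express, taking the topological input
— a `Γ_W`-EQUIVARIANT injective `ℂ`-linear map `T : H⁴(X_ψ(ℂ); ℂ) → H⁴(X⁴₆(ℂ); ℂ)` (parallel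
transport along a path from `ψ` to `0` in `ℂ ∖ μ₆`, composed with `X_0 = X⁴₆`) — as an explicit
HYPOTHESIS (no named fact is introduced; the tree has the transport for the universal family of
sextics, `universalHypersurfaceLocalSystemOfEhresmann`, and its commutation with endomorphisms over
the base, `transportFun_map_fiberHom`, but not yet a `Γ_W`-action on a family containing the Dwork
line):

* §1 `map_diagonalMap_mem_eigenspace` — the eigenspaces of a subgroup are stable under all diagonal
  symmetries (the `g_a^*` commute); `fermat_gammaW_eigenspace_le` — **the `Γ_W`-eigenspace of `χ` in
  `H⁴(X⁴₆(ℂ); ℂ)` is contained in the sum of the torus eigenlines `V(α)` with `χ_α|_{Γ_W} = χ`**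
  (decompose by the isotypic projectors of `μ₆⁶`, `sum_eigenProjector_apply`; a class on which `Γ_W`
  acts by two different characters is zero);
* §2 `fermatCharacter_comp_inclusion` (`χ_α|_{Γ_W} = χ_{⟨α⟩}`) and
  **`fermat_singleton_eigenspace_le_span`**: for `e = (1,2,3,3,4,5) ∘ σ` the `Γ_W`-eigenspace of
  `χ_e` in `H⁴(X⁴₆(ℂ); ℂ)` lies in a line — the `α` restricting to `χ_e` are `e + r·𝟙`
  (`exists_translate_of_character_eq`), `V(e + r·𝟙) = 0` for `r ≠ 0` (a zero coordinate,
  `fermatEigenspace_eq_bot_of_apply_eq_zero`) and `dim V(e) ≤ 1`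
  (`fermatEigenspace_le_span_of_ne_zero`, Pham–Milnor);
* §3 `map_mem_fermatEigenspace_of_equivariant` (an equivariant `T` maps `V_χ(X_ψ)` into `V_χ(X⁴₆)`),
  `exists_le_span_of_injective` (linear algebra) and
  **`singleton_rank_le_one_of_equivariant_transport`**: granted such a `T`, injective, every
  `V_{χ_{(1,2,3,3,4,5)∘σ}}(X_ψ)` lies in a line — the rank hypothesis of
  `DworkSexticSingletonPurity.flatClasses_mem_span_reflInvariant_singleton_of_rank_le_one`.

So, for the 360 singleton flat classes, crux K2 rests on the equivariant Ehresmann transport along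
the Dwork line alone (no Hodge-theoretic input beyond the tree's theorems).

## References

* [Katz2009] N. M. Katz, Another look at the Dwork family, Progr. Math. 270 (2009), §2 pp. 5–7,
  Lemma 3.1(1) and its proof (p. 8).
* [Shioda1979HodgeFermat] T. Shioda, The Hodge conjecture for Fermat varieties, Math. Ann. 245
  (1979), §1.
* [Ran1980] Z. Ran, Cycles on Fermat hypersurfaces, Compositio Math. 42 (1980), §1 Prop. 1.7 (i).
* [VoisinHodgeI2002] C. Voisin, Hodge Theory and Complex Algebraic Geometry I (2002), §9.2.1.
* [SerreLinearRepresentations1977] J.-P. Serre, Linear Representations of Finite Groups (1977),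
  §2.6 Thm. 8.
-/

noncomputable section

open CategoryTheory MvPolynomial Finset
open scoped BigOperators

namespace Literature.AlgebraicGeometry.HodgeTheory.DworkSextic

open Literature.AlgebraicGeometry.Motives Literature.AlgebraicTopology.SingularHomology

/-! ### §1 The `Γ_W`-eigenspaces of the Fermat sextic fourfold and the torus eigenlines -/

section Fermat

/-- `Γ_W ≤ μ₆⁶` stabilises the Fermat form `Σ xᵢ⁶` (`X_0 = X⁴₆`). [cite: Katz2009, §2 p. 5] -/
theorem gammaW_le_diagonalStabilizer_fermat : gammaW ≤ diagonalStabilizer (fermatPolynomial ℂ 4 6) :=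
  gammaW_le_fermatGroup.trans (fermatGroup_le_diagonalStabilizer 6)

variable {n : ℕ} {F : MvPolynomial (Fin (n + 2)) ℂ} {G : Subgroup (Fin (n + 2) → ℂˣ)}

/-- **Eigenspaces of a group of diagonal symmetries are stable under every diagonal symmetry**
(the `g_a^*` commute: `g_b^* g_a^* = g_{ab}^* = g_{ba}^* = g_a^* g_b^*`).
[cite: SerreLinearRepresentations1977, §2.6 Thm. 8] -/
theorem map_diagonalMap_mem_eigenspace (hG : G ≤ diagonalStabilizer F) {χ : G →* ℂˣ} {k : ℕ}
    {a : Fin (n + 2) → ℂˣ} (ha : a ∈ diagonalStabilizer F) {x : complexBetti (SmoothHypersurface.hypersurface F) k}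
    (hx : x ∈ diagonalCharacterEigenspace F G χ k) :
    singularCohomology.map ℂ ℂ (diagonalMap F ha) k x ∈ diagonalCharacterEigenspace F G χ k := by
  rw [mem_diagonalCharacterEigenspace_iff_diagonalMap hG] at hx ⊢
  intro b
  have h := congrArg (fun f => f x) (diagonalPullback_comm F (hG b.2) ha k)
  simp only [Module.End.mul_apply, diagonalPullback_apply] at h
  -- `h : g_b^* (g_a^* x) = g_a^* (g_b^* x)`
  rw [h, hx b, map_smul]

/-- … hence under the isotypic projectors of any larger group of diagonal symmetries.
[cite: SerreLinearRepresentations1977, §2.6 Thm. 8] -/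
theorem eigenProjector_mem_eigenspace (hG : G ≤ diagonalStabilizer F) {χ : G →* ℂˣ} {k : ℕ}
    {G' : Subgroup (Fin (n + 2) → ℂˣ)} [Fintype G'] (hG'd : G' ≤ diagonalStabilizer F) (θ : G' →* ℂˣ)
    {x : complexBetti (SmoothHypersurface.hypersurface F) k} (hx : x ∈ diagonalCharacterEigenspace F G χ k) :
    eigenProjector F θ k hG'd x ∈ diagonalCharacterEigenspace F G χ k := by
  rw [eigenProjector_apply]
  refine Submodule.smul_mem _ _ (Submodule.sum_mem _ fun a _ => Submodule.smul_mem _ _ ?_)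
  exact map_diagonalMap_mem_eigenspace hG (hG'd a.2) hx

/-- **A class on which a subgroup acts by two different characters is zero.**
[cite: SerreLinearRepresentations1977, §2.6 Thm. 8] -/
theorem eq_zero_of_mem_eigenspace_of_mem_eigenspace (hG : G ≤ diagonalStabilizer F) {χ χ' : G →* ℂˣ}
    {k : ℕ} (hne : χ ≠ χ') {x : complexBetti (SmoothHypersurface.hypersurface F) k}
    (hx : x ∈ diagonalCharacterEigenspace F G χ k) (hx' : x ∈ diagonalCharacterEigenspace F G χ' k) :
    x = 0 := by
  obtain ⟨b, hb⟩ : ∃ b, χ b ≠ χ' b :=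
    not_forall.mp fun h : ∀ b, χ b = χ' b => hne (MonoidHom.ext h)
  rw [mem_diagonalCharacterEigenspace_iff_diagonalMap hG] at hx hx'
  have h := (hx b).symm.trans (hx' b)
  rw [← sub_eq_zero, ← sub_smul] at h
  refine (smul_eq_zero.mp h).resolve_left (sub_ne_zero.mpr fun h' => hb (Units.val_injective h'))

/-- **The `Γ_W`-eigenspace of `χ` in `H⁴(X⁴₆(ℂ); ℂ)` lies in the sum of the torus eigenlines `V(α)`
with `χ_α|_{Γ_W} = χ`** (Katz, proof of Lemma 3.1: at the Fermat point the `Γ_W/Δ`-eigenspace of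
`V mod W` is `⊕_r` (the `μ₆⁶`-line of `V + rW`)). Decompose `x = Σ_θ π_θ x` over the characters `θ`
of `μ₆⁶` (`sum_eigenProjector_apply`); `π_θ x` lies in `V_θ` and in the `Γ_W`-eigenspace of `χ`, so
vanishes unless `θ|_{Γ_W} = χ`. [cite: Katz2009, Lemma 3.1 (proof, p. 8)]
[cite: SerreLinearRepresentations1977, §2.6 Thm. 8] -/
theorem fermat_gammaW_eigenspace_le (χ : gammaW →* ℂˣ) :
    diagonalCharacterEigenspace (fermatPolynomial ℂ 4 6) gammaW χ (2 * 2) ≤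
      ⨆ (α : Fin (4 + 2) → ZMod 6)
        (_ : (fermatCharacter 6 α).comp (Subgroup.inclusion gammaW_le_fermatGroup) = χ),
        fermatEigenspace 6 α (2 * 2) := by
  intro x hx
  have hGF := gammaW_le_diagonalStabilizer_fermat
  have hT := fermatGroup_le_diagonalStabilizer (n := 4) 6
  rw [← sum_eigenProjector_apply (fermatPolynomial ℂ 4 6) (k := 2 * 2) hT x]
  refine Submodule.sum_mem _ fun θ _ => ?_
  obtain ⟨α, rfl⟩ := (fermatCharacter_bijective (n := 4) (m := 6)).2 θ
  by_cases hα : (fermatCharacter 6 α).comp (Subgroup.inclusion gammaW_le_fermatGroup) = χ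
  · exact Submodule.mem_iSup_of_mem α (Submodule.mem_iSup_of_mem hα
      (eigenProjector_mem (fermatPolynomial ℂ 4 6) hT x))
  · -- `π_α x` is a `Γ_W`-eigenclass for both `χ_α|_{Γ_W}` and `χ`
    have h1 : eigenProjector (fermatPolynomial ℂ 4 6) (fermatCharacter 6 α) (2 * 2) hT x ∈
        diagonalCharacterEigenspace (fermatPolynomial ℂ 4 6) gammaW χ (2 * 2) :=
      eigenProjector_mem_eigenspace hGF hT _ hx
    have h2 : eigenProjector (fermatPolynomial ℂ 4 6) (fermatCharacter 6 α) (2 * 2) hT x ∈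
        diagonalCharacterEigenspace (fermatPolynomial ℂ 4 6) gammaW
          ((fermatCharacter 6 α).comp (Subgroup.inclusion gammaW_le_fermatGroup)) (2 * 2) := by
      have h := eigenProjector_mem (fermatPolynomial ℂ 4 6) hT (χ := fermatCharacter 6 α) (k := 2 * 2) x
      rw [mem_diagonalCharacterEigenspace_iff_diagonalMap hT] at h
      rw [mem_diagonalCharacterEigenspace_iff_diagonalMap hGF]
      intro b
      exact h (Subgroup.inclusion gammaW_le_fermatGroup b)
    rw [eq_zero_of_mem_eigenspace_of_mem_eigenspace hGF hα h2 h1]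
    exact Submodule.zero_mem _

end Fermat

/-! ### §2 The singleton type at the Fermat point: one line -/

section Singleton

/-- **`χ_α|_{Γ_W} = χ_{⟨α⟩}`**: the torus character of `α ∈ (ℤ/6)⁶` restricts on `Γ_W` to the
character of the exponent vector of representatives `⟨αᵢ⟩ ∈ {0,…,5}`. [cite: Katz2009, §2 p. 5] -/
theorem fermatCharacter_comp_inclusion (α : Fin (4 + 2) → ZMod 6) :
    (fermatCharacter 6 α).comp (Subgroup.inclusion gammaW_le_fermatGroup) =
      character fun k => (α k).val := by
  ext a
  rw [MonoidHom.comp_apply, fermatCharacter_apply, character_apply_val, Units.coe_prod]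
  rfl

/-- Every non-zero residue mod `6` is a value of the singleton type `(1,2,3,3,4,5)`. [cite: Katz2009, Lemma 3.1] -/
theorem exists_flatTypes_zero_eq (s : ZMod 6) (hs : s ≠ 0) : ∃ m : Fin 6, (flatTypes 0 m : ZMod 6) = s := by
  revert hs
  revert s
  decide

/-- The values of the singleton type are non-zero mod `6`. [cite: Katz2009, Lemma 3.1] -/
theorem flatTypes_zero_ne_zero (m : Fin 6) : (flatTypes 0 m : ZMod 6) ≠ 0 := by
  fin_cases m <;> decide

/-- **At the Fermat point the `Γ_W`-eigenspace of the singleton character is a line (or zero)**: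
for `e = (1,2,3,3,4,5) ∘ σ`, the `Γ_W`-eigenspace of `χ_e` in `H⁴(X⁴₆(ℂ); ℂ)` is contained in `ℂ·v`
for some `v`. The torus characters restricting to `χ_e` are the `α = e + r·𝟙`
(`exists_translate_of_character_eq`); for `r ≠ 0` some coordinate of `α` vanishes (`e` takes every
non-zero value), so `V(α) = 0` (`fermatEigenspace_eq_bot_of_apply_eq_zero`, Shioda 1979 §1), and
`V(e)` is at most a line (`fermatEigenspace_le_span_of_ne_zero`, Ran 1980 Prop. 1.7 (i)). This is
`#{r : e + r·𝟙 totally nonzero} = 1` of Katz's Lemma 3.1(1) at `ψ = 0`.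
[cite: Katz2009, Lemma 3.1(1)] [cite: Shioda1979HodgeFermat, §1] [cite: Ran1980, §1 Prop. 1.7 (i)] -/
theorem fermat_singleton_eigenspace_le_span (σ : Equiv.Perm (Fin 6)) :
    ∃ v, diagonalCharacterEigenspace (fermatPolynomial ℂ 4 6) gammaW
      (character fun k => flatTypes 0 (σ k)) (2 * 2) ≤ ℂ ∙ v := by
  set α₀ : Fin (4 + 2) → ZMod 6 := fun k => (flatTypes 0 (σ k) : ZMod 6) with hα₀def
  have hα₀ : α₀ ≠ 0 := fun h => flatTypes_zero_ne_zero (σ 0) (congrFun h 0)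
  obtain ⟨v, hv⟩ := fermatEigenspace_le_span_of_ne_zero (m := 6) (by norm_num) (r := 2) (by norm_num) 0 hα₀
  refine ⟨v, (fermat_gammaW_eigenspace_le _).trans (iSup₂_le fun α hα => ?_)⟩
  rw [fermatCharacter_comp_inclusion] at hα
  obtain ⟨r, hr⟩ := exists_translate_of_character_eq hα
  simp only [ZMod.natCast_val, ZMod.cast_id', id_eq] at hr
  by_cases hr0 : r = 0
  · -- `α = e`
    have hαe : α = α₀ := funext fun i => by rw [hr i, hr0, add_zero]
    rw [hαe]
    exact hv
  · -- `α = e + r·𝟙` has a zero coordinate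
    obtain ⟨m, hm⟩ := exists_flatTypes_zero_eq (-r) (neg_ne_zero.mpr hr0)
    have hi : α (σ.symm m) = 0 := by rw [hr, Equiv.apply_symm_apply, hm, neg_add_cancel]
    have hαne : α ≠ 0 := by
      intro h
      have h0 := hr (σ.symm 0)
      have h1 := hr (σ.symm 1)
      rw [h, Pi.zero_apply, Equiv.apply_symm_apply] at h0 h1
      have h01 : (flatTypes 0 0 : ZMod 6) = flatTypes 0 1 := by
        have := h0.symm.trans h1
        exact add_right_cancel this
      exact absurd h01 (by decide)
    rw [fermatEigenspace_eq_bot_of_apply_eq_zero (m := 6) (by norm_num) (r := 2) (by norm_num) hαne hi]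
    exact bot_le

end Singleton

/-! ### §3 Rank one at `ψ` from an equivariant injective transport to the Fermat point -/

section Transport

variable {ψ : ℂ}

/-- **An equivariant linear map carries `Γ_W`-eigenspaces of `X_ψ` into those of `X⁴₆`.** Here
`T : H⁴(X_ψ(ℂ); ℂ) → H⁴(X⁴₆(ℂ); ℂ)` intertwines the diagonal symmetries `g_a`, `a ∈ Γ_W`, of the two
sextics (as parallel transport along the Dwork line does: `Γ_W` acts on the family over the base,
Katz §3, and transport commutes with such endomorphisms, Voisin II §3.1.2).
[cite: Katz2009, §3 p. 92] [cite: VoisinHodgeI2002, §9.2.1] -/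
theorem map_mem_fermatEigenspace_of_equivariant
    {T : complexBetti (fibre ψ) (2 * 2) →ₗ[ℂ] complexBetti (fermatHypersurface 4 6) (2 * 2)}
    (hTeq : ∀ (a : gammaW) (c : complexBetti (fibre ψ) (2 * 2)),
      T (singularCohomology.map ℂ ℂ (diagonalMap (form ψ) (gammaW_le_diagonalStabilizer ψ a.2)) (2 * 2) c) =
        singularCohomology.map ℂ ℂ
          (diagonalMap (fermatPolynomial ℂ 4 6) (gammaW_le_diagonalStabilizer_fermat a.2)) (2 * 2) (T c))
    {χ : gammaW →* ℂˣ} {c : complexBetti (fibre ψ) (2 * 2)}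
    (hc : c ∈ diagonalCharacterEigenspace (form ψ) gammaW χ (2 * 2)) :
    T c ∈ diagonalCharacterEigenspace (fermatPolynomial ℂ 4 6) gammaW χ (2 * 2) := by
  rw [mem_diagonalCharacterEigenspace_iff_diagonalMap (gammaW_le_diagonalStabilizer ψ)] at hc
  rw [mem_diagonalCharacterEigenspace_iff_diagonalMap gammaW_le_diagonalStabilizer_fermat]
  intro a
  rw [← hTeq, hc a, map_smul]

/-- Linear algebra: a subspace mapped injectively into a line is contained in a line.
[cite: SerreLinearRepresentations1977, §2.6 Thm. 8] -/
theorem exists_le_span_of_injective {M N : Type*} [AddCommGroup M] [Module ℂ M] [AddCommGroup N]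
    [Module ℂ N] {V : Submodule ℂ M} {T : M →ₗ[ℂ] N} (hT : Function.Injective T) {v : N}
    (h : ∀ x ∈ V, T x ∈ ℂ ∙ v) : ∃ w, V ≤ ℂ ∙ w := by
  by_cases hV : ∀ x ∈ V, x = 0
  · exact ⟨0, fun x hx => by rw [hV x hx]; exact Submodule.zero_mem _⟩
  · simp only [not_forall, exists_prop] at hV
    obtain ⟨x₀, hx₀, hx₀0⟩ := hV
    refine ⟨x₀, fun x hx => ?_⟩
    obtain ⟨a, ha⟩ := Submodule.mem_span_singleton.mp (h x hx)
    obtain ⟨b, hb⟩ := Submodule.mem_span_singleton.mp (h x₀ hx₀)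
    have hb0 : b ≠ 0 := by
      rintro rfl
      rw [zero_smul] at hb
      exact hx₀0 (hT (by rw [← hb, map_zero]))
    refine Submodule.mem_span_singleton.mpr ⟨a / b, hT ?_⟩
    rw [map_smul, ← hb, smul_smul, div_mul_cancel₀ a hb0, ha]

/-- **Rank `≤ 1` of the singleton eigenspaces of `X_ψ`, granted an equivariant injective transport
to the Fermat point** (Katz's Lemma 3.1(1) for the type `(1,2,3,3,4,5)`, with its topological input
made an explicit hypothesis): if `T : H⁴(X_ψ(ℂ); ℂ) → H⁴(X⁴₆(ℂ); ℂ)` is `ℂ`-linear, injective and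
intertwines the `g_a`, `a ∈ Γ_W`, then for every `σ ∈ 𝔖₆` the eigenspace `V_{χ_{(1,2,3,3,4,5)∘σ}}` of
`H⁴(X_ψ(ℂ); ℂ)` lies in a line — the hypothesis `hrank` of
`flatClasses_mem_span_reflInvariant_singleton_of_rank_le_one` (file `DworkSexticSingletonPurity`).
[cite: Katz2009, Lemma 3.1(1)] [cite: VoisinHodgeI2002, §9.2.1] -/
theorem singleton_rank_le_one_of_equivariant_transport
    (T : complexBetti (fibre ψ) (2 * 2) →ₗ[ℂ] complexBetti (fermatHypersurface 4 6) (2 * 2))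
    (hT : Function.Injective T)
    (hTeq : ∀ (a : gammaW) (c : complexBetti (fibre ψ) (2 * 2)),
      T (singularCohomology.map ℂ ℂ (diagonalMap (form ψ) (gammaW_le_diagonalStabilizer ψ a.2)) (2 * 2) c) =
        singularCohomology.map ℂ ℂ
          (diagonalMap (fermatPolynomial ℂ 4 6) (gammaW_le_diagonalStabilizer_fermat a.2)) (2 * 2) (T c))
    (σ : Equiv.Perm (Fin 6)) :
    ∃ v, diagonalCharacterEigenspace (form ψ) gammaW (character fun k => flatTypes 0 (σ k)) (2 * 2) ≤
      ℂ ∙ v := by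
  obtain ⟨vF, hvF⟩ := fermat_singleton_eigenspace_le_span σ
  exact exists_le_span_of_injective hT fun x hx => hvF (map_mem_fermatEigenspace_of_equivariant hTeq hx)

end Transport

end Literature.AlgebraicGeometry.HodgeTheory.DworkSextic

end
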